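import Summits.Ventures.Crystal3D.Theorems.StickyWulffConstantGenericWallFloorRayTerraceB
import Summits.Ventures.Crystal3D.Theorems.StickyWulffConstantPolycrystalWulffBoundBondMirror
import HarnessLib

/-!
# The terrace-steered steep family, part 4: the MIRROR slot `(1,0,1)` — the same `hdirs` through the lattice symmetry
# swapping the cubic axes `0, 1` (crux `GenericWallFloor`, stmt-Ventures-19480, line `WallLedgerG`)

HONEST FRAMING. Venture `Summits/Ventures/Crystal3D` (cell `crystal3d-full`), helper `--supports` the crux
`GenericWallFloor` (stmt-Ventures-19480) of `route-Ventures-StickyWulffConstant`, REGISTERED line `WallLedgerG`, open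
stub `stub_twoSlabAdhesion`.  Rung credit only; F-C1 not moved; NOT the stub; census-free, standard axioms.

The walker menu of record on the `Σ3` cap (RISER-LEDGER-g8 §8) is the PAIR of steep start slots, cubic `(0,1,1)`
(`slotSite 8`, parts 2–3) and `(1,0,1)` (`slotSite 4`), the second with the mirrored steering `(32,34,33)`.  The second
family is the first one seen through the lattice symmetry `S` = reflection in the plane `⊥ slotSite 1` (cubic `(1,−1,0)/√2`),
which swaps the cubic axes `0` and `1`:
* `cubicCoords_swapReflection` (`κ(Sx) = (κ₁, κ₀, κ₂)`), `swapReflection_slotSite_eight` (`S·slotSite 8 = slotSite 4`),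
  `swapReflection_image_fcc` (`S·Λ₀ = Λ₀`, from `reflection_image_lattice_eq_of_bond`), `image_swap_trans`
  (`(S ≫ A)·Λ₀ = A·Λ₀`: the frame `A ∘ S` presents the SAME grain);
* **`stack_dirs_terrace_mirror`**: for every sound well-formed `z`-stack over `⟨A ∘ S, slotSite 8, 0⟩` (start direction
  `A·slotSite 4`, steering `cubicCoords (A.symm z) ∥ (32,34,33)`) every entry has `⟪e.frame e.dir, w⟫ ≥ 1/2 − ‖A.symm w − w₀‖`
  — the W1 hypothesis for the mirror family with the SAME constant (`w₀`, cubic `(1,1,4)/(3√2)`, is `S`-invariant);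
* `exists_terrace_steering_mirror`: the unit steering `ẑ'` (cubic `(32,34,33)/√3269`), the steepness
  `⟪A·slotSite 4, A ẑ'⟫ ≥ √2/2`, and the `hZ` datum for the frame `A ∘ S`.
WHAT THIS IS NOT: not the ledger, no packing statement; F-C1 not moved.
-/

noncomputable section

namespace Summit.Ventures.Crystal3D.Theorems

open Summit.Ventures.Crystal3D Finset Matrix
open Literature.MathematicalPhysics.StatisticalMechanics (fccStacking)
open scoped InnerProductSpace

/-! ### The swap symmetry -/

/-- The bond `slotSite 1` has cubic numerator `(1, −1, 0)`. -/
theorem cubicCoords_slotSite_one : cubicCoords (slotSite 1) = (Real.sqrt 2)⁻¹ • (![1, -1, 0] : Fin 3 → ℝ) := by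
  rw [cubicCoords_slotSite]
  ext i
  fin_cases i <;> simp [NearIdentity.slotVec, NearIdentity.slotInt, div_eq_mul_inv]

/-- **The reflection in the plane `⊥ slotSite 1` swaps the cubic axes `0` and `1`.** -/
theorem cubicCoords_swapReflection (x : EuclideanSpace ℝ (Fin 3)) :
    cubicCoords ((ℝ ∙ slotSite 1)ᗮ.reflection x) = ![cubicCoords x 1, cubicCoords x 0, cubicCoords x 2] := by
  obtain ⟨hs2, -, hs2p, -, -⟩ := sqrt_two_three_facts
  have h1 : ‖slotSite 1‖ = 1 := norm_eq_one_of_mem_fccSlots (slotSite_mem 1)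
  rw [reflection_unit_apply h1, cubicCoords_sub, cubicCoords_smul, inner_eq_cubicCoords, cubicCoords_slotSite_one]
  have hd : cubicCoords x ⬝ᵥ ((Real.sqrt 2)⁻¹ • (![1, -1, 0] : Fin 3 → ℝ)) =
      (Real.sqrt 2)⁻¹ * (cubicCoords x 0 - cubicCoords x 1) := by
    rw [dotProduct_smul, smul_eq_mul]
    simp [dotProduct, Fin.sum_univ_three]
    ring
  rw [hd, smul_smul]
  have hc : 2 * ((Real.sqrt 2)⁻¹ * (cubicCoords x 0 - cubicCoords x 1)) * (Real.sqrt 2)⁻¹ =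
      cubicCoords x 0 - cubicCoords x 1 := by
    have hs2' : Real.sqrt 2 ^ 2 = 2 := by rw [sq]; exact hs2
    field_simp; rw [hs2']
  rw [hc]
  ext i
  fin_cases i <;> simp

/-- `S · slotSite 8 = slotSite 4`: the swap takes the start slot `(0,1,1)` to `(1,0,1)`. -/
theorem swapReflection_slotSite_eight : (ℝ ∙ slotSite 1)ᗮ.reflection (slotSite 8) = slotSite 4 := by
  apply cubicCoords_injective
  rw [cubicCoords_swapReflection, cubicCoords_slotSite_eight, cubicCoords_slotSite]
  ext i
  fin_cases i <;> simp [NearIdentity.slotVec, NearIdentity.slotInt, div_eq_mul_inv]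

/-- The cap-centre vertical is `S`-invariant. -/
theorem swapReflection_capCentre {w₀ : EuclideanSpace ℝ (Fin 3)}
    (hw₀ : cubicCoords w₀ = (3 * Real.sqrt 2)⁻¹ • (![(1 : ℝ), 1, 4] : Fin 3 → ℝ)) :
    (ℝ ∙ slotSite 1)ᗮ.reflection w₀ = w₀ := by
  apply cubicCoords_injective
  rw [cubicCoords_swapReflection, hw₀]
  ext i
  fin_cases i <;> simp

/-- A vector with cubic numerator `∥ (a, b, c)` goes to one with numerator `∥ (b, a, c)`. -/
theorem cubicCoords_swapReflection_smul {x : EuclideanSpace ℝ (Fin 3)} {t a b c : ℝ}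
    (hx : cubicCoords x = t • (![a, b, c] : Fin 3 → ℝ)) :
    cubicCoords ((ℝ ∙ slotSite 1)ᗮ.reflection x) = t • (![b, a, c] : Fin 3 → ℝ) := by
  rw [cubicCoords_swapReflection, hx]
  ext i
  fin_cases i <;> simp

/-- **`S` maps the reference lattice onto itself** (it is the reflection in a bond). -/
theorem swapReflection_image_fcc :
    (ℝ ∙ slotSite 1)ᗮ.reflection '' fccStacking 1 (Real.sqrt (2 / 3)) = fccStacking 1 (Real.sqrt (2 / 3)) := by
  have h := reflection_image_lattice_eq_of_bond (LinearIsometryEquiv.refl ℝ (EuclideanSpace ℝ (Fin 3)))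
    (u := slotSite 1) (by
      refine ⟨slotSite 1, mem_fcc_of_mem_fccSlots (slotSite_mem 1), rfl⟩)
    (norm_eq_one_of_mem_fccSlots (slotSite_mem 1))
  simpa using h

/-- **The frame `A ∘ S` presents the same grain**: `(S ≫ A)·Λ₀ = A·Λ₀`. -/
theorem image_swap_trans (A : EuclideanSpace ℝ (Fin 3) ≃ₗᵢ[ℝ] EuclideanSpace ℝ (Fin 3)) :
    ((ℝ ∙ slotSite 1)ᗮ.reflection.trans A) '' fccStacking 1 (Real.sqrt (2 / 3)) = A '' fccStacking 1 (Real.sqrt (2 / 3)) := by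
  rw [LinearIsometryEquiv.coe_trans, Set.image_comp, swapReflection_image_fcc]

/-! ### `hdirs` for the mirror family -/

/-- **The W1 hypothesis for the MIRROR slot `(1,0,1)`** (same constant as `stack_dirs_terrace_of_near`): for every sound
well-formed `z`-stack over the bottom `⟨A ∘ S, slotSite 8, 0⟩` — start direction `A·slotSite 4`, steering with
`cubicCoords (A.symm z) ∥ (32, 34, 33)` — every entry has `⟪e.frame e.dir, w⟫ ≥ 1/2 − ‖A.symm w − w₀‖`. -/
theorem stack_dirs_terrace_mirror (A : EuclideanSpace ℝ (Fin 3) ≃ₗᵢ[ℝ] EuclideanSpace ℝ (Fin 3))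
    {z w₀ : EuclideanSpace ℝ (Fin 3)} {t : ℝ}
    (hZ : cubicCoords (A.symm z) = t • (![(32 : ℝ), 34, 33] : Fin 3 → ℝ)) (ht : 0 < t)
    (hw₀ : cubicCoords w₀ = (3 * Real.sqrt 2)⁻¹ • (![(1 : ℝ), 1, 4] : Fin 3 → ℝ)) (w : EuclideanSpace ℝ (Fin 3)) :
    ∀ stk : List WalkEntry, StackSound z stk → StackWF z stk →
      stk.getLast? = some ⟨(ℝ ∙ slotSite 1)ᗮ.reflection.trans A, slotSite 8, 0⟩ →
      ∀ e ∈ stk, 1 / 2 - ‖A.symm w - w₀‖ ≤ ⟪e.frame e.dir, w⟫_ℝ := by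
  have hSsymm : ∀ y, (ℝ ∙ slotSite 1)ᗮ.reflection.symm y = (ℝ ∙ slotSite 1)ᗮ.reflection y := fun y => by
    rw [Submodule.reflection_symm]
  have hZ' : cubicCoords (((ℝ ∙ slotSite 1)ᗮ.reflection.trans A).symm z) = t • (![(34 : ℝ), 32, 33] : Fin 3 → ℝ) := by
    rw [LinearIsometryEquiv.symm_trans, LinearIsometryEquiv.trans_apply, hSsymm]
    exact cubicCoords_swapReflection_smul hZ
  intro stk hSo hW hlast e he
  have h := stack_dirs_terrace_of_near ((ℝ ∙ slotSite 1)ᗮ.reflection.trans A) hZ' ht hw₀ w stk hSo hW hlast e he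
  have hn : ‖((ℝ ∙ slotSite 1)ᗮ.reflection.trans A).symm w - w₀‖ = ‖A.symm w - w₀‖ := by
    rw [LinearIsometryEquiv.symm_trans, LinearIsometryEquiv.trans_apply, hSsymm]
    conv_lhs => rw [← swapReflection_capCentre hw₀]
    rw [← map_sub, LinearIsometryEquiv.norm_map]
  rw [hn] at h
  exact h

/-- **The mirror steering exists**: a unit `ẑ'` with `cubicCoords ẑ' = (32,34,33)/√3269`; for every frame `A`: the frame
`A ∘ S` starts along `A·slotSite 4`, its steering datum is `cubicCoords ((A ∘ S).symm (A ẑ')) = (√3269)⁻¹ • (34,32,33)`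
(so parts 2–3 apply verbatim to `A ∘ S` with `z = A ẑ'`), and the start slot is steep: `⟪A·slotSite 4, A ẑ'⟫ ≥ √2/2`. -/
theorem exists_terrace_steering_mirror :
    ∃ zs' : EuclideanSpace ℝ (Fin 3), ‖zs'‖ = 1 ∧
      cubicCoords zs' = (Real.sqrt 3269)⁻¹ • (![(32 : ℝ), 34, 33] : Fin 3 → ℝ) ∧ 0 < (Real.sqrt 3269)⁻¹ ∧
      ∀ A : EuclideanSpace ℝ (Fin 3) ≃ₗᵢ[ℝ] EuclideanSpace ℝ (Fin 3),
        ((ℝ ∙ slotSite 1)ᗮ.reflection.trans A) (slotSite 8) = A (slotSite 4) ∧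
        ((ℝ ∙ slotSite 1)ᗮ.reflection.trans A) ((ℝ ∙ slotSite 1)ᗮ.reflection zs') = A zs' ∧
        cubicCoords (A.symm (A zs')) = (Real.sqrt 3269)⁻¹ • (![(32 : ℝ), 34, 33] : Fin 3 → ℝ) ∧
        cubicCoords (((ℝ ∙ slotSite 1)ᗮ.reflection.trans A).symm (A zs')) =
          (Real.sqrt 3269)⁻¹ • (![(34 : ℝ), 32, 33] : Fin 3 → ℝ) ∧
        Real.sqrt 2 / 2 ≤ ⟪A (slotSite 4), A zs'⟫_ℝ := by
  obtain ⟨zs, hzs1, hzsc, ht, hA⟩ := exists_terrace_steering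
  have hSsymm : ∀ y, (ℝ ∙ slotSite 1)ᗮ.reflection.symm y = (ℝ ∙ slotSite 1)ᗮ.reflection y := fun y => by
    rw [Submodule.reflection_symm]
  have hSS : ∀ y : EuclideanSpace ℝ (Fin 3), (ℝ ∙ slotSite 1)ᗮ.reflection ((ℝ ∙ slotSite 1)ᗮ.reflection y) = y :=
    fun y => by rw [Submodule.reflection_reflection]
  refine ⟨(ℝ ∙ slotSite 1)ᗮ.reflection zs, by rw [LinearIsometryEquiv.norm_map, hzs1],
    cubicCoords_swapReflection_smul hzsc, ht, fun A => ⟨?_, ?_, ?_, ?_, ?_⟩⟩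
  · rw [LinearIsometryEquiv.trans_apply, swapReflection_slotSite_eight]
  · rw [LinearIsometryEquiv.trans_apply, hSS]
  · rw [A.symm_apply_apply]; exact cubicCoords_swapReflection_smul hzsc
  · rw [LinearIsometryEquiv.symm_trans, LinearIsometryEquiv.trans_apply, A.symm_apply_apply, hSsymm, hSS, hzsc]
  · have h := (hA ((ℝ ∙ slotSite 1)ᗮ.reflection.trans A)).2
    rw [LinearIsometryEquiv.trans_apply, LinearIsometryEquiv.trans_apply, swapReflection_slotSite_eight] at h
    exact h

end Summit.Ventures.Crystal3D.Theorems

end
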